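import Summits.BirchSwinnertonDyer.BirchSwinnertonDyer.Theorems.ManinLocalTwoThreeManinOddAtFourOfOrdJLeZero
import Summits.BirchSwinnertonDyer.BirchSwinnertonDyer.Theorems.ManinLocalTwoThreeManinOddAtFourOfSemistableTwist
import Summits.BirchSwinnertonDyer.BirchSwinnertonDyer.Theorems.ManinLocalTwoThreeNegOneTwistTypeTwoFour
import Summits.BirchSwinnertonDyer.BirchSwinnertonDyer.Theorems.ManinLocalTwoThreeNegOneTwistIstarZeroEight
import Summits.BirchSwinnertonDyer.BirchSwinnertonDyer.Theorems.ManinLocalTwoThreeNegOneTwistIstarTwoTen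
import Literature.NumberTheory.EllipticCurves.BarriosEtAl2025.QuadraticTwistAtTwoConductorProofs
import Literature.NumberTheory.EllipticCurves.QuadraticTwist
import Literature.NumberTheory.EllipticCurves.RootNumberSmulProofs
import Literature.NumberTheory.EllipticCurves.IsogenyQuadraticTwistProofs
import Literature.NumberTheory.EllipticCurves.IsogenyConductorModularityProofs
import Literature.NumberTheory.Automorphic.ShimuraCurveRibetTakahashiOptimalProofs
import HarnessLib

/-!
# At `2`: «no dyadic twist is semistable» ⟹ «potentially supersingular»; `v₂(N) ∉ {4, 6}` ⟹ `|j|₂ < 1`; the C2 core is ISOGENY-INVARIANT mod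
# modularity; and the E-blind DICTIONARY at `16 ∥ N`: core ⟺ Kodaira row `II/4`, `I₀*/8`, `I₂*/10`, `I₃*/11`, twist-covered ⟺ `I₄*/12`, `II*/12`,
# `Iₙ≥5*/(n+8)` (route `ManinLocalTwoThree`, crux C2 `ManinOddAtFour` stmt-BirchSwinnertonDyer-22967; cell bsd-f2-manin, p2 gen 15)

The `p = 2` twin of this seat's `…ResidualCoreBinders` / `…WildAtThreePotSupersingular` / `…TernaryTwistAdditiveOfNonIstar`.
* §0 Barrios Thm. 5.1 read backwards for `d ∈ {−1, 2, −2}` (re-derived from the tree fact so the file is independent of p708503's build):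
  `f₂(W) ∉ {4, 6}` ⟹ `2 ≤ f₂(W ⊗ d)`.
* §1 g14's local law `exists_eq_dyadicTwist_of_semistable_of_valuation_j_eq_exp_of_hasAdditiveReductionAt` (p704515) says an additive `W` with
  `|j|₂ = 2^ν ≥ 1` HAS a `2`-semistable dyadic twist (`W ⊗ d ≅ (T ⊗ u) ⊗ d² ≅ T ⊗ u`); hence the twist binder of `maninOddAtFour_of_core` (p705358)
  implies its `j` binder (`valuation_j_lt_one_of_forall_two_le_conductorExponent_dyadicTwist`; the C2 LEAD's remark 2026-08-29T08:03:46Z, now a theorem).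
* §2 `f₂(W) ∉ {0, 1, 4, 6}` ⟹ `|j(W)|₂ < 1`: every curve with `v₂(N) ∈ {2, 3, 5, 7, 8}` is potentially SUPERSINGULAR at `2`; contrapositively
  `ord₂ j ≤ 0` and additive ⟹ `f₂ ∈ {4, 6}` (E-blind form of p704515's Kodaira rows).
* §3 the twist binder transports along isogenies mod modularity, hence so does the core (`coreBindersTwo_iff_of_isIsogenous`) — no
  «potential supersingularity is an isogeny invariant» fact needed.
* §4–§5 at `16 ∥ N`: on the rows `II/4`, `I₀*/8`, `I₂*/10`, `I₃*/11` every dyadic twist is additive (p3 g12's `χ₋₄` row conductors + §0 for `±2`) and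
  `|j|₂ < 1`; at `f₂ = 4`: «some dyadic twist semistable» ⟺ row `I₄*/12 ∨ II*/12 ∨ Iₙ≥5*/(n+8)` (p3 rows `= 0, 0, 1`), «all dyadic twists additive»
  ⟺ one of the four core rows (`kodairaSymbolAt_of_conductorExponent_eq_four_two` makes the list exhaustive).
HONEST FRAMING: local structure / bookkeeping by name; nothing about BSD, Manin's conjecture or C2 is proved; C2 OPEN on the core.
[cite: BarriosEtAl2025, Thm. 5.1, Table tab:localdata-dodd (arXiv:2501.03209 pp. 15–16)] [cite: SilvermanAEC2009, VII.5 Prop. 5.1, X.5 Cor. 5.4 and Cor. 5.4.1]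
[cite: SilvermanATAEC1994, IV.9.4 Table 4.1, IV.11.1, V.5 Lemma 5.1] [cite: DiamondShurman2005, Thm. 8.8.1]
-/

set_option autoImplicit false
-- lint-debt: the directory name repeats the summit name (sibling precedent `ManinLocalTwoThreeManinOddAtFourOfOrdJLeZero.lean`)
set_option linter.dupNamespace false

noncomputable section

open scoped Classical NumberField
open WeierstrassCurve IsDedekindDomain IsDedekindDomain.HeightOneSpectrum Rat.HeightOneSpectrum
  Literature.NumberTheory.DiophantineGeometry Literature.NumberTheory.EllipticCurves

namespace Summit.BirchSwinnertonDyer.BirchSwinnertonDyer.Theorems.ManinLocalTwoThree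

/-! ## §0 Barrios Thm. 5.1 read backwards on `d ∈ {−1, 2, −2}` (self-contained specialisation of `…DyadicSemistableTwistConductor`) -/

/-- **A `2`-semistable dyadic twist pins `f₂(W)`** (`d ∈ {−1, 2, −2}` specialisation of p708503, re-derived from the Barrios fact so that this
file does not wait for that module's build): `f₂(W ⊗ d) ≤ 1` ⟹ `f₂(W) = 4` if `d = −1`, `= 6` if `d = ±2` (`W ≅ (W ⊗ d) ⊗ d`).
[cite: BarriosEtAl2025, Thm. 5.1 (arXiv:2501.03209 pp. 15–16)] [cite: SilvermanAEC2009, X.5 Cor. 5.4] -/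
theorem conductorExponent_eq_of_conductorExponent_dyadicTwist_le_one (v : HeightOneSpectrum ℤ) (hv : natGenerator v = 2)
    (W : WeierstrassCurve ℚ) [W.IsElliptic] {d : ℤ} (hd : d = -1 ∨ d = 2 ∨ d = -2)
    (hle : (W.quadraticTwist (d : ℚ)).conductorExponent v ≤ 1) :
    (d = -1 → W.conductorExponent v = 4) ∧ (d = 2 ∨ d = -2 → W.conductorExponent v = 6) := by
  have hd0 : d ≠ 0 := by omega
  have hd0' : (d : ℚ) ≠ 0 := by exact_mod_cast hd0
  haveI := W.isElliptic_quadraticTwist hd0'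
  haveI := (W.quadraticTwist (d : ℚ)).isElliptic_quadraticTwist hd0'
  -- `W ≅ (W ⊗ d) ⊗ d`
  obtain ⟨C₁, hC₁⟩ := W.exists_variableChange_quadraticTwist_mul_sq 1 (d : ℚ) hd0'
  obtain ⟨C₂, hC₂⟩ := W.exists_variableChange_quadraticTwist_one
  have hC : (C₁ * C₂) • W = (W.quadraticTwist (d : ℚ)).quadraticTwist (d : ℚ) := by
    rw [mul_smul, hC₂, hC₁, quadraticTwist_quadraticTwist, one_mul, sq]
  have hfW : W.conductorExponent v = ((W.quadraticTwist (d : ℚ)).quadraticTwist (d : ℚ)).conductorExponent v := by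
    rw [← hC, conductorExponent_smul']
  have key := Literature.NumberTheory.EllipticCurves.BarriosEtAl2025.conductorExponent_quadraticTwist_two_of_le_one_holds
    (W.quadraticTwist (d : ℚ)) v hv hle d
  refine ⟨fun h ↦ hfW.trans (key.1 (by subst h; decide)), fun h ↦ hfW.trans (key.2 ?_)⟩
  rcases h with rfl | rfl <;> decide

/-- **Off `f₂ ∈ {4, 6}` every dyadic twist is additive at `2`**; at `f₂ = 4` the twists by `±2` are additive, at `f₂ = 6` the twist by `−1` is.
[cite: BarriosEtAl2025, Thm. 5.1 (arXiv:2501.03209 pp. 15–16)] -/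
theorem two_le_conductorExponent_dyadicTwist_of_ne_four_of_ne_six' (v : HeightOneSpectrum ℤ) (hv : natGenerator v = 2)
    (W : WeierstrassCurve ℚ) [W.IsElliptic] {d : ℤ} (hd : d = -1 ∨ d = 2 ∨ d = -2)
    (h4 : d = -1 → W.conductorExponent v ≠ 4) (h6 : d = 2 ∨ d = -2 → W.conductorExponent v ≠ 6) :
    2 ≤ (W.quadraticTwist (d : ℚ)).conductorExponent v := by
  by_contra hlt
  have key := conductorExponent_eq_of_conductorExponent_dyadicTwist_le_one v hv W hd (by omega)
  rcases hd with h | h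
  · exact h4 h (key.1 h)
  · exact h6 h (key.2 h)

/-! ## §1 The twist binder implies the `j` binder -/

/-- **At `2`: additive with `|j|₂ = 2^ν ≥ 1` ⟹ the dyadic twist `W ⊗ d` of the g14 decomposition is SEMISTABLE** (`f₂(W ⊗ d) ≤ 1` for the
`d ∈ {−1, 2, −2}` with `C • W = (T ⊗ u) ⊗ d`: `W ⊗ d ≅ (T ⊗ u) ⊗ d² ≅ T ⊗ u`).
[cite: SilvermanAEC2009, X.5 Cor. 5.4 and Cor. 5.4.1] [cite: SilvermanATAEC1994, V.5 Lemma 5.1] -/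
theorem exists_conductorExponent_dyadicTwist_le_one_of_valuation_j_eq_exp_of_hasAdditiveReductionAt
    {v : HeightOneSpectrum (𝓞 ℚ)} (hv : natGenerator v = 2) (W : WeierstrassCurve ℚ) [W.IsElliptic] {ν : ℕ}
    (hν : v.valuation ℚ W.j = WithZero.exp (ν : ℤ)) (hadd : W.HasAdditiveReductionAt v) :
    ∃ d : ℤ, (d = -1 ∨ d = 2 ∨ d = -2) ∧
      (W.quadraticTwist (d : ℚ)).conductorExponent ((primesEquiv (R := ℤ)).symm ⟨2, Nat.prime_two⟩) ≤ 1 := by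
  set vZ : HeightOneSpectrum ℤ := (primesEquiv (R := ℤ)).symm ⟨2, Nat.prime_two⟩ with hvZdef
  have hvZ : natGenerator vZ = 2 := congrArg Subtype.val ((primesEquiv (R := ℤ)).apply_symm_apply ⟨2, Nat.prime_two⟩)
  have hvv : primesEquiv vZ = primesEquiv v := by
    apply Subtype.ext
    change natGenerator vZ = natGenerator v
    rw [hvZ, hv]
  obtain ⟨hj0, hj1728, -⟩ := W.j_ne_and_valuation_j_sub_eq_of_valuation_j_eq_exp v hv hν
  haveI := isElliptic_tateFormOfJ hj0 hj1728
  obtain ⟨u, d, C, hu, hd, hC, hfu⟩ :=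
    exists_eq_dyadicTwist_of_semistable_of_valuation_j_eq_exp_of_hasAdditiveReductionAt v hv W hν hadd
  have hu0 : ((u : ℤ) : ℚ) ≠ 0 := by exact_mod_cast (show u ≠ 0 by omega)
  have hd0 : ((d : ℤ) : ℚ) ≠ 0 := by exact_mod_cast (show d ≠ 0 by omega)
  set T := tateFormOfJ W.j with hT
  haveI := T.isElliptic_quadraticTwist hu0
  haveI := W.isElliptic_quadraticTwist hd0
  refine ⟨d, hd, ?_⟩
  -- `C₁ • (W ⊗ d) = (C • W) ⊗ d = ((T ⊗ u) ⊗ d) ⊗ d = (T ⊗ u) ⊗ d² = C₂ • ((T ⊗ u) ⊗ 1) = (C₂ * C₃) • (T ⊗ u)`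
  obtain ⟨C₂, hC₂⟩ := (T.quadraticTwist (u : ℚ)).exists_variableChange_quadraticTwist_mul_sq 1 ((d : ℤ) : ℚ) hd0
  obtain ⟨C₃, hC₃⟩ := (T.quadraticTwist (u : ℚ)).exists_variableChange_quadraticTwist_one
  have hkey : (⟨C.u, ((d : ℤ) : ℚ) * C.r, 0, 0⟩ : VariableChange ℚ) • W.quadraticTwist (d : ℚ) =
      (C₂ * C₃) • T.quadraticTwist (u : ℚ) := by
    rw [← WeierstrassCurve.quadraticTwist_smul, hC, quadraticTwist_quadraticTwist, mul_smul, hC₃, hC₂, one_mul, sq]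
  have hf : (W.quadraticTwist (d : ℚ)).conductorExponent vZ = (T.quadraticTwist (u : ℚ)).conductorExponent vZ := by
    rw [← conductorExponent_smul' vZ (W.quadraticTwist (d : ℚ)) (⟨C.u, ((d : ℤ) : ℚ) * C.r, 0, 0⟩ : VariableChange ℚ), hkey,
      conductorExponent_smul']
  rw [hf, WeierstrassCurve.conductorExponent_eq_of_primesEquiv_eq vZ v _ hvv]
  exact hfu

/-- **The twist binder of the C2 core implies the `j` binder.**  At the place `v ∋ 2` of `𝓞 ℚ`: if `W` is additive at `v` and `2 ≤ f₂(W ⊗ d)` for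
each `d ∈ {−1, 2, −2}` (no dyadic twist semistable at `2`), then `|j(W)|₂ < 1` (potentially supersingular at `2`).
[cite: SilvermanAEC2009, VII.5 Prop. 5.1 and X.5 Cor. 5.4.1] -/
theorem valuation_j_lt_one_of_forall_two_le_conductorExponent_dyadicTwist
    {v : HeightOneSpectrum (𝓞 ℚ)} (hv : natGenerator v = 2) (W : WeierstrassCurve ℚ) [W.IsElliptic] (hadd : W.HasAdditiveReductionAt v)
    (htw : ∀ d : ℤ, d = -1 ∨ d = 2 ∨ d = -2 →
      2 ≤ (W.quadraticTwist (d : ℚ)).conductorExponent ((primesEquiv (R := ℤ)).symm ⟨2, Nat.prime_two⟩)) :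
    v.valuation ℚ W.j < 1 := by
  by_contra hj
  have hj' : 1 ≤ v.valuation ℚ W.j := not_lt.mp hj
  have key : ∀ {ν : ℕ}, v.valuation ℚ W.j = WithZero.exp (ν : ℤ) → False := fun hν ↦ by
    obtain ⟨d, hd, hf⟩ := exists_conductorExponent_dyadicTwist_le_one_of_valuation_j_eq_exp_of_hasAdditiveReductionAt hv W hν hadd
    have := htw d hd
    omega
  rcases hj'.eq_or_lt with h | h
  · exact key (W.valuation_j_eq_exp_zero_of_eq_one v h.symm)
  · obtain ⟨ν, -, hν⟩ := W.exists_valuation_j_eq_exp v h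
    exact key hν

/-! ## §2 `f₂ ∉ {0, 1, 4, 6}` ⟹ potentially supersingular at `2` -/

/-- **Additive at `2` with `f₂(W) ∉ {4, 6}` ⟹ `|j(W)|₂ < 1`.**  Every elliptic curve over `ℚ` with `v₂(N) ∈ {2, 3, 5, 7, 8}` is potentially
SUPERSINGULAR at `2` (equivalently: potentially multiplicative or potentially good ordinary reduction at an additive `2` forces `f₂ ∈ {4, 6}`).
§1 with the twist binder supplied by `two_le_conductorExponent_dyadicTwist_of_ne_four_of_ne_six` (Barrios Thm. 5.1).
[cite: BarriosEtAl2025, Thm. 5.1 (arXiv:2501.03209 pp. 15–16)] [cite: SilvermanAEC2009, X.5 Cor. 5.4.1] -/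
theorem valuation_j_lt_one_of_conductorExponent_two_ne_four_ne_six (W : WeierstrassCurve ℚ) [W.IsElliptic]
    (h2 : 2 ≤ W.conductorExponent ((primesEquiv (R := ℤ)).symm ⟨2, Nat.prime_two⟩))
    (h4 : W.conductorExponent ((primesEquiv (R := ℤ)).symm ⟨2, Nat.prime_two⟩) ≠ 4)
    (h6 : W.conductorExponent ((primesEquiv (R := ℤ)).symm ⟨2, Nat.prime_two⟩) ≠ 6) :
    ((primesEquiv (R := 𝓞 ℚ)).symm ⟨2, Nat.prime_two⟩).valuation ℚ W.j < 1 := by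
  set vZ : HeightOneSpectrum ℤ := (primesEquiv (R := ℤ)).symm ⟨2, Nat.prime_two⟩ with hvZdef
  set v : HeightOneSpectrum (𝓞 ℚ) := (primesEquiv (R := 𝓞 ℚ)).symm ⟨2, Nat.prime_two⟩ with hvdef
  have hvZ : natGenerator vZ = 2 := congrArg Subtype.val ((primesEquiv (R := ℤ)).apply_symm_apply ⟨2, Nat.prime_two⟩)
  have hv : natGenerator v = 2 := congrArg Subtype.val ((primesEquiv (R := 𝓞 ℚ)).apply_symm_apply ⟨2, Nat.prime_two⟩)
  haveI : PerfectField (IsLocalRing.ResidueField (vZ.adicCompletionIntegers ℚ)) := PerfectField.ofFinite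
  have haddZ : W.HasAdditiveReductionAt vZ := (two_le_conductorExponent_iff_holds vZ W).mp h2
  have hadd : W.HasAdditiveReductionAt v := (W.hasAdditiveReductionAt_int_iff_ringOfIntegers ⟨2, Nat.prime_two⟩).mp haddZ
  exact valuation_j_lt_one_of_forall_two_le_conductorExponent_dyadicTwist hv W hadd
    fun d hd ↦ two_le_conductorExponent_dyadicTwist_of_ne_four_of_ne_six' vZ hvZ W hd (fun _ ↦ h4) (fun _ ↦ h6)

/-- **Conductor-norm currency: `4 ∣ N(W)` and `v₂(N(W)) ∉ {4, 6}` ⟹ `|j(W)|₂ < 1`.** [cite: BarriosEtAl2025, Thm. 5.1 (arXiv:2501.03209 pp. 15–16)] -/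
theorem valuation_j_lt_one_of_factorization_two_ne_four_ne_six (W : WeierstrassCurve ℚ) [W.IsElliptic]
    (hN4 : 2 ^ 2 ∣ W.conductorNorm ℤ) (h4 : (W.conductorNorm ℤ).factorization 2 ≠ 4) (h6 : (W.conductorNorm ℤ).factorization 2 ≠ 6) :
    ((primesEquiv (R := 𝓞 ℚ)).symm ⟨2, Nat.prime_two⟩).valuation ℚ W.j < 1 := by
  have hfac : (W.conductorNorm ℤ).factorization 2 = W.conductorExponent ((primesEquiv (R := ℤ)).symm ⟨2, Nat.prime_two⟩) :=
    factorization_conductorNorm_primesEquiv_symm W ⟨2, Nat.prime_two⟩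
  refine valuation_j_lt_one_of_conductorExponent_two_ne_four_ne_six W ?_ (by rwa [← hfac]) (by rwa [← hfac])
  rw [← hfac]
  exact (Nat.prime_two.pow_dvd_iff_le_factorization (W.conductorNorm_pos_holds).ne').mp hN4

/-- **Contrapositive: additive at `2` with `ord₂ j ≤ 0` ⟹ `f₂ ∈ {4, 6}`** (the E-blind form of the rows `I₄*/12`, `Iₙ≥5*/(n+8)` [`f₂ = 4`] and
`I₈*/18`, `Iₙ≥9*/(n+10)` [`f₂ = 6`]). [cite: BarriosEtAl2025, Thm. 5.1] [cite: SilvermanATAEC1994, IV.9.4 Table 4.1 and IV.11.1] -/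
theorem conductorExponent_two_eq_four_or_six_of_one_le_valuation_j (W : WeierstrassCurve ℚ) [W.IsElliptic]
    (h2 : 2 ≤ W.conductorExponent ((primesEquiv (R := ℤ)).symm ⟨2, Nat.prime_two⟩))
    (hj : 1 ≤ ((primesEquiv (R := 𝓞 ℚ)).symm ⟨2, Nat.prime_two⟩).valuation ℚ W.j) :
    W.conductorExponent ((primesEquiv (R := ℤ)).symm ⟨2, Nat.prime_two⟩) = 4 ∨
      W.conductorExponent ((primesEquiv (R := ℤ)).symm ⟨2, Nat.prime_two⟩) = 6 := by
  by_contra h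
  push Not at h
  exact absurd (valuation_j_lt_one_of_conductorExponent_two_ne_four_ne_six W h2 h.1 h.2) (not_lt.mpr hj)

/-! ## §3 The C2 core is cut out by the twist binder and is ISOGENY-INVARIANT modulo modularity -/

/-- **The dyadic twist binder transports along isogenies, modulo modularity**: for isogenous elliptic `W ∼ W'` over `ℚ` and `d ≠ 0`,
`f₂(W ⊗ d) = f₂(W' ⊗ d)` at the place of `ℤ` above `2` (the twists are isogenous, `IsIsogenous.quadraticTwist`; equal conductors given
modularity, `conductorNorm_eq_of_isIsogenous_of_modularity`). [cite: DiamondShurman2005, Thm. 8.8.1] [cite: CremonaAlgorithms1997, §3.9] -/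
theorem conductorExponent_quadraticTwist_two_eq_of_isIsogenous (hnf : Literature.NumberTheory.EllipticCurves.ModularForms.exists_isNewformOf)
    {W W' : WeierstrassCurve ℚ} [W.IsElliptic] [W'.IsElliptic] (hiso : IsIsogenous W W') {d : ℤ} (hd0 : d ≠ 0) :
    (haveI := W.isElliptic_quadraticTwist (show (d : ℚ) ≠ 0 by exact_mod_cast hd0);
      (W.quadraticTwist (d : ℚ)).conductorExponent ((primesEquiv (R := ℤ)).symm ⟨2, Nat.prime_two⟩)) =
    (haveI := W'.isElliptic_quadraticTwist (show (d : ℚ) ≠ 0 by exact_mod_cast hd0);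
      (W'.quadraticTwist (d : ℚ)).conductorExponent ((primesEquiv (R := ℤ)).symm ⟨2, Nat.prime_two⟩)) := by
  have hd0' : (d : ℚ) ≠ 0 := by exact_mod_cast hd0
  haveI := W.isElliptic_quadraticTwist hd0'
  haveI := W'.isElliptic_quadraticTwist hd0'
  have hmod : Literature.NumberTheory.EllipticCurves.ModularForms.nonempty_modularParametrizationData :=
    Literature.NumberTheory.EllipticCurves.ModularForms.nonempty_modularParametrizationData_iff_exists_isNewformOf_unconditional.mpr hnf
  have hN : (W.quadraticTwist (d : ℚ)).conductorNorm ℤ = (W'.quadraticTwist (d : ℚ)).conductorNorm ℤ :=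
    Literature.NumberTheory.EllipticCurves.ModularForms.conductorNorm_eq_of_isIsogenous_of_modularity hmod _ _ (hiso.quadraticTwist hd0')
  rw [← factorization_conductorNorm_primesEquiv_symm (W.quadraticTwist (d : ℚ)) ⟨2, Nat.prime_two⟩,
    ← factorization_conductorNorm_primesEquiv_symm (W'.quadraticTwist (d : ℚ)) ⟨2, Nat.prime_two⟩, hN]

/-- **The C2 core is ISOGENY-INVARIANT modulo modularity.**  For isogenous elliptic `W ∼ W'` over `ℚ` with `4 ∣ N(W)` (`= N(W')`): the C2 core
binders («`|j|₂ < 1`» ∧ «`2 ≤ f₂(· ⊗ d)` for `d ∈ {−1, 2, −2}`») hold at `W` iff they hold at `W'` — the twist binder transports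
(`conductorExponent_quadraticTwist_two_eq_of_isIsogenous`) and implies the `j` binder at either curve (§1).  No isogeny-invariance of potential
supersingularity is needed. [cite: DiamondShurman2005, Thm. 8.8.1] [cite: SilvermanAEC2009, X.5 Cor. 5.4.1] -/
theorem coreBindersTwo_iff_of_isIsogenous (hnf : Literature.NumberTheory.EllipticCurves.ModularForms.exists_isNewformOf)
    {W W' : WeierstrassCurve ℚ} [W.IsElliptic] [W'.IsElliptic] (hiso : IsIsogenous W W') (h4 : 2 ^ 2 ∣ W.conductorNorm ℤ) :
    (((primesEquiv (R := 𝓞 ℚ)).symm ⟨2, Nat.prime_two⟩).valuation ℚ W.j < 1 ∧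
      ∀ d : ℤ, d = -1 ∨ d = 2 ∨ d = -2 →
        2 ≤ (W.quadraticTwist (d : ℚ)).conductorExponent ((primesEquiv (R := ℤ)).symm ⟨2, Nat.prime_two⟩)) ↔
    (((primesEquiv (R := 𝓞 ℚ)).symm ⟨2, Nat.prime_two⟩).valuation ℚ W'.j < 1 ∧
      ∀ d : ℤ, d = -1 ∨ d = 2 ∨ d = -2 →
        2 ≤ (W'.quadraticTwist (d : ℚ)).conductorExponent ((primesEquiv (R := ℤ)).symm ⟨2, Nat.prime_two⟩)) := by
  set vZ : HeightOneSpectrum ℤ := (primesEquiv (R := ℤ)).symm ⟨2, Nat.prime_two⟩ with hvZdef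
  set v : HeightOneSpectrum (𝓞 ℚ) := (primesEquiv (R := 𝓞 ℚ)).symm ⟨2, Nat.prime_two⟩ with hvdef
  have hv : natGenerator v = 2 := congrArg Subtype.val ((primesEquiv (R := 𝓞 ℚ)).apply_symm_apply ⟨2, Nat.prime_two⟩)
  haveI : PerfectField (IsLocalRing.ResidueField (vZ.adicCompletionIntegers ℚ)) := PerfectField.ofFinite
  have hmod : Literature.NumberTheory.EllipticCurves.ModularForms.nonempty_modularParametrizationData :=
    Literature.NumberTheory.EllipticCurves.ModularForms.nonempty_modularParametrizationData_iff_exists_isNewformOf_unconditional.mpr hnf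
  have h4' : 2 ^ 2 ∣ W'.conductorNorm ℤ := by
    rwa [← Literature.NumberTheory.EllipticCurves.ModularForms.conductorNorm_eq_of_isIsogenous_of_modularity hmod W W' hiso]
  -- both curves are additive at `2`
  have hadd : ∀ (V : WeierstrassCurve ℚ) [V.IsElliptic], 2 ^ 2 ∣ V.conductorNorm ℤ → V.HasAdditiveReductionAt v := by
    intro V _ hV
    have hfac : (V.conductorNorm ℤ).factorization 2 = V.conductorExponent vZ := factorization_conductorNorm_primesEquiv_symm V ⟨2, Nat.prime_two⟩
    have haddZ : V.HasAdditiveReductionAt vZ := by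
      refine (two_le_conductorExponent_iff_holds vZ V).mp ?_
      rw [← hfac]
      exact (Nat.prime_two.pow_dvd_iff_le_factorization (V.conductorNorm_pos_holds).ne').mp hV
    exact (V.hasAdditiveReductionAt_int_iff_ringOfIntegers ⟨2, Nat.prime_two⟩).mp haddZ
  have htrans : ∀ d : ℤ, d = -1 ∨ d = 2 ∨ d = -2 →
      (W.quadraticTwist (d : ℚ)).conductorExponent vZ = (W'.quadraticTwist (d : ℚ)).conductorExponent vZ :=
    fun d hd ↦ conductorExponent_quadraticTwist_two_eq_of_isIsogenous hnf hiso (by omega)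
  constructor
  · rintro ⟨-, htw⟩
    have htw' : ∀ d : ℤ, d = -1 ∨ d = 2 ∨ d = -2 → 2 ≤ (W'.quadraticTwist (d : ℚ)).conductorExponent vZ :=
      fun d hd ↦ (htrans d hd) ▸ htw d hd
    exact ⟨valuation_j_lt_one_of_forall_two_le_conductorExponent_dyadicTwist hv W' (hadd W' h4') htw', htw'⟩
  · rintro ⟨-, htw'⟩
    have htw : ∀ d : ℤ, d = -1 ∨ d = 2 ∨ d = -2 → 2 ≤ (W.quadraticTwist (d : ℚ)).conductorExponent vZ :=
      fun d hd ↦ (htrans d hd).symm ▸ htw' d hd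
    exact ⟨valuation_j_lt_one_of_forall_two_le_conductorExponent_dyadicTwist hv W (hadd W h4) htw, htw⟩


/-! ## §4 The four core rows: every dyadic twist additive, potentially supersingular -/

/-- **On the rows `II/4`, `I₀*/8`, `I₂*/10`, `I₃*/11` at `2` the twist by `−1` is additive** (`f₂(W ⊗ (−1)) ∈ {2, 3}`, p3 g12's row theorems).
[cite: BarriosEtAl2025, Thm. 5.1 rows II, I₀*, I₂*, I₃* (arXiv:2501.03209 p. 16)] -/
theorem two_le_conductorExponent_quadraticTwist_negOne_of_coreRow_sixteen (W : WeierstrassCurve ℚ) [W.IsElliptic]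
    (hrow : (W.kodairaSymbolAt ((primesEquiv (R := ℤ)).symm ⟨2, Nat.prime_two⟩) = .II ∧
        W.ordMinimalDiscriminant ((primesEquiv (R := ℤ)).symm ⟨2, Nat.prime_two⟩) = 4) ∨
      (W.kodairaSymbolAt ((primesEquiv (R := ℤ)).symm ⟨2, Nat.prime_two⟩) = .Istar 0 ∧
        W.ordMinimalDiscriminant ((primesEquiv (R := ℤ)).symm ⟨2, Nat.prime_two⟩) = 8) ∨
      (W.kodairaSymbolAt ((primesEquiv (R := ℤ)).symm ⟨2, Nat.prime_two⟩) = .Istar 2 ∧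
        W.ordMinimalDiscriminant ((primesEquiv (R := ℤ)).symm ⟨2, Nat.prime_two⟩) = 10) ∨
      (W.kodairaSymbolAt ((primesEquiv (R := ℤ)).symm ⟨2, Nat.prime_two⟩) = .Istar 3 ∧
        W.ordMinimalDiscriminant ((primesEquiv (R := ℤ)).symm ⟨2, Nat.prime_two⟩) = 11)) :
    2 ≤ (W.quadraticTwist ((-1 : ℤ) : ℚ)).conductorExponent ((primesEquiv (R := ℤ)).symm ⟨2, Nat.prime_two⟩) := by
  rcases hrow with ⟨hK, hord⟩ | ⟨hK, hord⟩ | ⟨hK, hord⟩ | ⟨hK, hord⟩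
  · rcases conductorExponent_quadraticTwist_negOne_of_II_four W hK hord with h | h <;> omega
  · rcases conductorExponent_quadraticTwist_negOne_of_IstarZero_eight W hK hord with h | h <;> omega
  · have h := conductorExponent_quadraticTwist_negOne_of_IstarTwo_ten W hK hord; omega
  · have h := conductorExponent_quadraticTwist_negOne_of_IstarThree_eleven W hK hord; omega

/-- **On the four core rows at `16 ∥ N` EVERY dyadic twist is additive at `2`** (`d = −1`: the row theorems; `d = ±2`: at `f₂ = 4` by Barrios
Thm. 5.1 read backwards, `two_le_conductorExponent_quadraticTwist_two_of_eq_four`). [cite: BarriosEtAl2025, Thm. 5.1 (arXiv:2501.03209 pp. 15–16)] -/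
theorem two_le_conductorExponent_dyadicTwist_of_coreRow_sixteen (W : WeierstrassCurve ℚ) [W.IsElliptic]
    (hf : W.conductorExponent ((primesEquiv (R := ℤ)).symm ⟨2, Nat.prime_two⟩) = 4)
    (hrow : (W.kodairaSymbolAt ((primesEquiv (R := ℤ)).symm ⟨2, Nat.prime_two⟩) = .II ∧
        W.ordMinimalDiscriminant ((primesEquiv (R := ℤ)).symm ⟨2, Nat.prime_two⟩) = 4) ∨
      (W.kodairaSymbolAt ((primesEquiv (R := ℤ)).symm ⟨2, Nat.prime_two⟩) = .Istar 0 ∧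
        W.ordMinimalDiscriminant ((primesEquiv (R := ℤ)).symm ⟨2, Nat.prime_two⟩) = 8) ∨
      (W.kodairaSymbolAt ((primesEquiv (R := ℤ)).symm ⟨2, Nat.prime_two⟩) = .Istar 2 ∧
        W.ordMinimalDiscriminant ((primesEquiv (R := ℤ)).symm ⟨2, Nat.prime_two⟩) = 10) ∨
      (W.kodairaSymbolAt ((primesEquiv (R := ℤ)).symm ⟨2, Nat.prime_two⟩) = .Istar 3 ∧
        W.ordMinimalDiscriminant ((primesEquiv (R := ℤ)).symm ⟨2, Nat.prime_two⟩) = 11))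
    {d : ℤ} (hd : d = -1 ∨ d = 2 ∨ d = -2) :
    2 ≤ (W.quadraticTwist (d : ℚ)).conductorExponent ((primesEquiv (R := ℤ)).symm ⟨2, Nat.prime_two⟩) := by
  have hv : natGenerator ((primesEquiv (R := ℤ)).symm ⟨2, Nat.prime_two⟩) = 2 :=
    congrArg Subtype.val ((primesEquiv (R := ℤ)).apply_symm_apply ⟨2, Nat.prime_two⟩)
  rcases hd with rfl | h2
  · exact two_le_conductorExponent_quadraticTwist_negOne_of_coreRow_sixteen W hrow
  · exact two_le_conductorExponent_dyadicTwist_of_ne_four_of_ne_six' _ hv W (Or.inr h2) (fun h ↦ by omega) (fun _ ↦ by omega)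

/-- `|j|₂ < 1` from the twist binder at `f₂ = 4` (additivity read off `f₂`; `…DyadicCoreBinders` §1 at the `ℤ`-place). [folklore] -/
theorem valuation_j_lt_one_of_conductorExponent_two_eq_four_of_forall (W : WeierstrassCurve ℚ) [W.IsElliptic]
    (hf : W.conductorExponent ((primesEquiv (R := ℤ)).symm ⟨2, Nat.prime_two⟩) = 4)
    (htw : ∀ d : ℤ, d = -1 ∨ d = 2 ∨ d = -2 →
      2 ≤ (W.quadraticTwist (d : ℚ)).conductorExponent ((primesEquiv (R := ℤ)).symm ⟨2, Nat.prime_two⟩)) :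
    ((primesEquiv (R := 𝓞 ℚ)).symm ⟨2, Nat.prime_two⟩).valuation ℚ W.j < 1 := by
  set vZ : HeightOneSpectrum ℤ := (primesEquiv (R := ℤ)).symm ⟨2, Nat.prime_two⟩ with hvZdef
  set v : HeightOneSpectrum (𝓞 ℚ) := (primesEquiv (R := 𝓞 ℚ)).symm ⟨2, Nat.prime_two⟩ with hvdef
  have hv : natGenerator v = 2 := congrArg Subtype.val ((primesEquiv (R := 𝓞 ℚ)).apply_symm_apply ⟨2, Nat.prime_two⟩)
  haveI : PerfectField (IsLocalRing.ResidueField (vZ.adicCompletionIntegers ℚ)) := PerfectField.ofFinite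
  have haddZ : W.HasAdditiveReductionAt vZ := (two_le_conductorExponent_iff_holds vZ W).mp (by omega)
  have hadd : W.HasAdditiveReductionAt v := (W.hasAdditiveReductionAt_int_iff_ringOfIntegers ⟨2, Nat.prime_two⟩).mp haddZ
  exact valuation_j_lt_one_of_forall_two_le_conductorExponent_dyadicTwist hv W hadd htw

/-- **The four core rows at `16 ∥ N` are potentially SUPERSINGULAR**: `|j(W)|₂ < 1` (twist binder ⟹ `j` binder, `…DyadicCoreBinders`).
[cite: BarriosEtAl2025, Thm. 5.1] [cite: SilvermanAEC2009, X.5 Cor. 5.4.1] -/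
theorem valuation_j_lt_one_of_coreRow_sixteen (W : WeierstrassCurve ℚ) [W.IsElliptic]
    (hf : W.conductorExponent ((primesEquiv (R := ℤ)).symm ⟨2, Nat.prime_two⟩) = 4)
    (hrow : (W.kodairaSymbolAt ((primesEquiv (R := ℤ)).symm ⟨2, Nat.prime_two⟩) = .II ∧
        W.ordMinimalDiscriminant ((primesEquiv (R := ℤ)).symm ⟨2, Nat.prime_two⟩) = 4) ∨
      (W.kodairaSymbolAt ((primesEquiv (R := ℤ)).symm ⟨2, Nat.prime_two⟩) = .Istar 0 ∧
        W.ordMinimalDiscriminant ((primesEquiv (R := ℤ)).symm ⟨2, Nat.prime_two⟩) = 8) ∨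
      (W.kodairaSymbolAt ((primesEquiv (R := ℤ)).symm ⟨2, Nat.prime_two⟩) = .Istar 2 ∧
        W.ordMinimalDiscriminant ((primesEquiv (R := ℤ)).symm ⟨2, Nat.prime_two⟩) = 10) ∨
      (W.kodairaSymbolAt ((primesEquiv (R := ℤ)).symm ⟨2, Nat.prime_two⟩) = .Istar 3 ∧
        W.ordMinimalDiscriminant ((primesEquiv (R := ℤ)).symm ⟨2, Nat.prime_two⟩) = 11)) :
    ((primesEquiv (R := 𝓞 ℚ)).symm ⟨2, Nat.prime_two⟩).valuation ℚ W.j < 1 :=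
  valuation_j_lt_one_of_conductorExponent_two_eq_four_of_forall W hf
    (fun _ hd ↦ two_le_conductorExponent_dyadicTwist_of_coreRow_sixteen W hf hrow hd)

/-! ## §5 The dictionary at `f₂ = 4` -/

/-- **At `f₂ = 4`: some dyadic twist is `2`-semistable iff the Kodaira row is `I₄*/12`, `II*/12` or `Iₙ≥5*/(n+8)`** (⟸: the `χ₋₄`-twist is
good resp. multiplicative, p3 g12 rows; ⟹: the other four rows have all dyadic twists additive, §1; the list is exhaustive by
`kodairaSymbolAt_of_conductorExponent_eq_four_two`). [cite: BarriosEtAl2025, Thm. 5.1 (arXiv:2501.03209 pp. 15–16)] -/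
theorem exists_conductorExponent_dyadicTwist_le_one_iff_row_sixteen (W : WeierstrassCurve ℚ) [W.IsElliptic]
    (hf : W.conductorExponent ((primesEquiv (R := ℤ)).symm ⟨2, Nat.prime_two⟩) = 4) :
    (∃ d : ℤ, (d = -1 ∨ d = 2 ∨ d = -2) ∧
        (W.quadraticTwist (d : ℚ)).conductorExponent ((primesEquiv (R := ℤ)).symm ⟨2, Nat.prime_two⟩) ≤ 1) ↔
      ((W.kodairaSymbolAt ((primesEquiv (R := ℤ)).symm ⟨2, Nat.prime_two⟩) = .Istar 4 ∧
          W.ordMinimalDiscriminant ((primesEquiv (R := ℤ)).symm ⟨2, Nat.prime_two⟩) = 12) ∨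
        (W.kodairaSymbolAt ((primesEquiv (R := ℤ)).symm ⟨2, Nat.prime_two⟩) = .IIstar ∧
          W.ordMinimalDiscriminant ((primesEquiv (R := ℤ)).symm ⟨2, Nat.prime_two⟩) = 12) ∨
        (∃ n : ℕ, W.kodairaSymbolAt ((primesEquiv (R := ℤ)).symm ⟨2, Nat.prime_two⟩) = .Istar (n + 5) ∧
          W.ordMinimalDiscriminant ((primesEquiv (R := ℤ)).symm ⟨2, Nat.prime_two⟩) = n + 13)) := by
  have hv : natGenerator ((primesEquiv (R := ℤ)).symm ⟨2, Nat.prime_two⟩) = 2 :=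
    congrArg Subtype.val ((primesEquiv (R := ℤ)).apply_symm_apply ⟨2, Nat.prime_two⟩)
  constructor
  · rintro ⟨d, hd, hle⟩
    rcases kodairaSymbolAt_of_conductorExponent_eq_four_two W _ hv hf with
      ⟨h, h'⟩ | ⟨h, h'⟩ | ⟨h, h'⟩ | ⟨h, h'⟩ | ⟨h, h'⟩ | ⟨h, h'⟩ | ⟨n, h, h'⟩
    · have := two_le_conductorExponent_dyadicTwist_of_coreRow_sixteen W hf (Or.inl ⟨h, h'⟩) hd; omega
    · have := two_le_conductorExponent_dyadicTwist_of_coreRow_sixteen W hf (Or.inr (Or.inl ⟨h, h'⟩)) hd; omega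
    · have := two_le_conductorExponent_dyadicTwist_of_coreRow_sixteen W hf (Or.inr (Or.inr (Or.inl ⟨h, h'⟩))) hd; omega
    · have := two_le_conductorExponent_dyadicTwist_of_coreRow_sixteen W hf (Or.inr (Or.inr (Or.inr ⟨h, h'⟩))) hd; omega
    · exact Or.inl ⟨h, h'⟩
    · exact Or.inr (Or.inl ⟨h, h'⟩)
    · exact Or.inr (Or.inr ⟨n, h, h'⟩)
  · rintro (⟨hK, hord⟩ | ⟨hK, hord⟩ | ⟨n, hK, hord⟩)
    · exact ⟨-1, Or.inl rfl, (conductorExponent_quadraticTwist_negOne_of_IstarFour_twelve W hK hord).le.trans zero_le_one⟩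
    · exact ⟨-1, Or.inl rfl, (conductorExponent_quadraticTwist_negOne_of_IIstar_twelve W hK hord).le.trans zero_le_one⟩
    · exact ⟨-1, Or.inl rfl, (conductorExponent_quadraticTwist_negOne_of_Istar_of_five_le W (n := n + 5) (by omega) hK hord).le⟩

/-- **The E-blind C2 core at `16 ∥ N` is EXACTLY the four rows `II/4`, `I₀*/8`, `I₂*/10`, `I₃*/11`**: at `f₂ = 4`, «every dyadic twist additive
at `2`» ⟺ the Kodaira row is one of the four (and then `|j|₂ < 1` by §1). [cite: BarriosEtAl2025, Thm. 5.1 (arXiv:2501.03209 pp. 15–16)] -/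
theorem forall_two_le_conductorExponent_dyadicTwist_iff_coreRow_sixteen (W : WeierstrassCurve ℚ) [W.IsElliptic]
    (hf : W.conductorExponent ((primesEquiv (R := ℤ)).symm ⟨2, Nat.prime_two⟩) = 4) :
    (∀ d : ℤ, d = -1 ∨ d = 2 ∨ d = -2 →
        2 ≤ (W.quadraticTwist (d : ℚ)).conductorExponent ((primesEquiv (R := ℤ)).symm ⟨2, Nat.prime_two⟩)) ↔
      ((W.kodairaSymbolAt ((primesEquiv (R := ℤ)).symm ⟨2, Nat.prime_two⟩) = .II ∧
          W.ordMinimalDiscriminant ((primesEquiv (R := ℤ)).symm ⟨2, Nat.prime_two⟩) = 4) ∨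
        (W.kodairaSymbolAt ((primesEquiv (R := ℤ)).symm ⟨2, Nat.prime_two⟩) = .Istar 0 ∧
          W.ordMinimalDiscriminant ((primesEquiv (R := ℤ)).symm ⟨2, Nat.prime_two⟩) = 8) ∨
        (W.kodairaSymbolAt ((primesEquiv (R := ℤ)).symm ⟨2, Nat.prime_two⟩) = .Istar 2 ∧
          W.ordMinimalDiscriminant ((primesEquiv (R := ℤ)).symm ⟨2, Nat.prime_two⟩) = 10) ∨
        (W.kodairaSymbolAt ((primesEquiv (R := ℤ)).symm ⟨2, Nat.prime_two⟩) = .Istar 3 ∧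
          W.ordMinimalDiscriminant ((primesEquiv (R := ℤ)).symm ⟨2, Nat.prime_two⟩) = 11)) := by
  have hv : natGenerator ((primesEquiv (R := ℤ)).symm ⟨2, Nat.prime_two⟩) = 2 :=
    congrArg Subtype.val ((primesEquiv (R := ℤ)).apply_symm_apply ⟨2, Nat.prime_two⟩)
  constructor
  · intro htw
    rcases kodairaSymbolAt_of_conductorExponent_eq_four_two W _ hv hf with
      ⟨h, h'⟩ | ⟨h, h'⟩ | ⟨h, h'⟩ | ⟨h, h'⟩ | ⟨h, h'⟩ | ⟨h, h'⟩ | ⟨n, h, h'⟩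
    · exact Or.inl ⟨h, h'⟩
    · exact Or.inr (Or.inl ⟨h, h'⟩)
    · exact Or.inr (Or.inr (Or.inl ⟨h, h'⟩))
    · exact Or.inr (Or.inr (Or.inr ⟨h, h'⟩))
    · have h0 := conductorExponent_quadraticTwist_negOne_of_IstarFour_twelve W h h'
      have := htw (-1) (Or.inl rfl); omega
    · have h0 := conductorExponent_quadraticTwist_negOne_of_IIstar_twelve W h h'
      have := htw (-1) (Or.inl rfl); omega
    · have h1 := conductorExponent_quadraticTwist_negOne_of_Istar_of_five_le W (n := n + 5) (by omega) h h'
      have := htw (-1) (Or.inl rfl); omega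
  · intro hrow d hd
    exact two_le_conductorExponent_dyadicTwist_of_coreRow_sixteen W hf hrow hd

end Summit.BirchSwinnertonDyer.BirchSwinnertonDyer.Theorems.ManinLocalTwoThree

end
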